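import Summits.HodgeConjecture.HodgeConjecture.Theorems.Ring2WeilCoverageRealUnitNormCyclicLevels
import Summits.HodgeConjecture.HodgeConjecture.Theorems.Ring2WeilCoverageRealUnitNormNonExceptional
import HarnessLib

/-!
# Weil-type family coverage — THE CONVERSE OF THEOREM L (i) AT THE LEVELS `2^a` (HASSE'S UNIT), AND THE DICHOTOMY:
# for `n ≥ 3`, `ℚ(ζₙ)⁺` has a unit of norm `−1` iff `n ∈ {2^a, p^a, 2p^a}` iff `(ℤ/n)ˣ` is cyclic or `n` is a power of `2`

research route conditional on HC_CM; not a corollary; Q11.4-sentence-2 already refuted in dim ≥ 3.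

Ring 2, WEIL-TYPE FAMILY-COVERAGE CENSUS (`HOME/WEIL-FAMILY-COVERAGE.md` `## b01`, block b01.45; owner ring2-b01), part 73
of the `Ring2WeilCoverage*` series.  Part 72 settled the cyclic levels `4, p^a, 2p^a`; here `n = 2^a`, `a ≥ 2`, where
`(ℤ/n)ˣ = ⟨−1⟩ × ⟨5⟩` is not cyclic and the half-system is `T = {5^i : i < 2^{a−2}}` (Mathlib `ZMod.orderOf_five`;
`5^i ≢ −5^j` already mod `4`).  HASSE'S UNIT `u = ζ^{−2}(1 + ζ + ζ² + ζ³ + ζ⁴) = 1 + (ζ + ζ^{−1}) + (ζ² + ζ^{−2})`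
(`= (η⁵ − η^{−5})/(η − η^{−1})` for `η² = ζ`) is a real unit of `ℤ[ζ]`, and with `μ(j) = ζ^j − 1`,
`σ_t(u) = ζ^{−2t}·μ(5t)/μ(t)`, so

  `N_{K⁺/ℚ}(u) = ∏_{i<d} σ_{5^i}(u) = ζ^{−2·Σ_{i<d} 5^i} · μ(5^d)/μ(1) = ζ^{−(5^d − 1)/2}`,  `d = 2^{a−2}`,

and `5^d − 1 = 2^a·q` with `q` ODD (`ord(5 mod 2^{a+1}) = 2^{a−1} > d`), so `ζ^{(5^d−1)/2} = (ζ^{2^{a−1}})^q = −1`.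

* §1 `five_pow_two_pow_eq` (`5^{2^k} = 2^{k+2}·q + 1`, `q` odd), `isCMTypeSet_powers_of_five`;
* §2 **`exists_units_norm_eq_neg_one_of_two_pow`** — at `n = 2^{k+2}` some unit of `𝓞 ℚ(ζₙ)⁺` has norm `−1`;
* §3 **THE DICHOTOMY** (with parts 67/68/72): for `n ≥ 3`, `norm_units_eq_one_or_eq_neg_one` (a unit has norm `±1`),
  **`exists_units_norm_eq_neg_one_iff`** (`∃` unit of norm `−1` ⟺ `n = 2^a ∨ n = p^a ∨ n = 2p^a`),
  **`forall_norm_pos_iff`** (the census hypothesis `hN` ⟺ `n ∉ {2^a, p^a, 2p^a}`), and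
  `exists_units_norm_eq_neg_one_iff_isCyclic_or` (⟺ `(ℤ/n)ˣ` cyclic or `n` a power of `2`).

WHAT THIS GIVES THE CENSUS: the obstruction input `hN` of the polarisation-type criteria (parts 2/7/48/53/55/60b) is now
DECIDED at every cyclotomic level: it holds exactly at the non-exceptional levels (part 68) and FAILS at every
exceptional one (this file) — at `2^a, p^a, 2p^a` the norm-sign law of parts 55/56 is genuinely one-sided and part 60b's
second alternative («a real unit of norm `−1`») always occurs.

HONEST FRAMING: elementary algebraic number theory (cyclotomic units, the structure of `(ℤ/2^a)ˣ`); nothing here is a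
statement about Hodge classes, `W_K`, general members or HC; `HC_CM` is used nowhere.  No `def`, no named fact, no
`sorry`.

References: [cite: DummitDummitKisilevsky2019, §3 Prop. 2 (Weber) and the paragraph after it (Hasse's unit)] (Weber 1899;
Hasse's unit `(ζ_{2^{n+1}}^5 − ζ_{2^{n+1}}^{−5})/(ζ_{2^{n+1}} − ζ_{2^{n+1}}^{−1})` of norm `−1` in `ℚ(ζ_{2^n})⁺`);
[cite: Washington1997, §8.1, Lemma 8.1 (p. 144)]; [cite: Garbanati1976UnitsNormMinusOne] (units of norm `−1` in real
abelian fields); census b01.44 (E), b01.45.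
-/

noncomputable section

open scoped Classical nonZeroDivisors NumberField
open NumberField Module Finset

namespace Summit.HodgeConjecture.Ring2WeilCoverage.RealUnitNormPowersOfTwo

open Literature.AlgebraicGeometry.HodgeTheory (IsCMTypeSet)
open Summit.HodgeConjecture.Ring2WeilCoverage.RealUnitNormReduction (exists_aut_apply_eq_pow)
open Summit.HodgeConjecture.Ring2WeilCoverage.RealUnitNormHalfSystems
open Summit.HodgeConjecture.Ring2WeilCoverage.RealUnitNormCyclicLevels
open Summit.HodgeConjecture.Ring2WeilCoverage.RealUnitNormNonExceptional (norm_realUnits_pos_of_not_exceptional)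

/-! ### §1 `5` modulo powers of `2`: `5^{2^k} = 2^{k+2}·(odd) + 1`, and the half-system `{5^i : i < 2^k}` -/

section Five

/-- **`5^{2^k} = 2^{k+2}·q + 1` with `q` ODD**: `ord(5 mod 2^{k+2}) = 2^k` and `ord(5 mod 2^{k+3}) = 2^{k+1}` (Mathlib
`ZMod.orderOf_five`).
research route conditional on HC_CM; not a corollary; Q11.4-sentence-2 already refuted in dim ≥ 3. [folklore] -/
theorem five_pow_two_pow_eq (k : ℕ) : ∃ q : ℕ, Odd q ∧ 5 ^ 2 ^ k = 2 ^ (k + 2) * q + 1 := by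
  have h1 : (5 : ZMod (2 ^ (k + 2))) ^ 2 ^ k = 1 := by
    rw [← ZMod.orderOf_five k]; exact pow_orderOf_eq_one _
  have hmod : 1 ≡ 5 ^ 2 ^ k [MOD 2 ^ (k + 2)] := by
    rw [← ZMod.natCast_eq_natCast_iff, Nat.cast_one, Nat.cast_pow, Nat.cast_ofNat, h1]
  obtain ⟨q, hq⟩ := (Nat.modEq_iff_dvd' (Nat.one_le_pow _ _ (by norm_num))).mp hmod
  have hq' : 5 ^ 2 ^ k = 2 ^ (k + 2) * q + 1 := by
    have := Nat.one_le_pow (2 ^ k) 5 (by norm_num)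
    omega
  refine ⟨q, ?_, hq'⟩
  by_contra heven
  rw [Nat.not_odd_iff_even] at heven
  obtain ⟨q', rfl⟩ := heven
  -- then `5^{2^k} ≡ 1 (mod 2^{k+3})`, contradicting `ord(5 mod 2^{k+3}) = 2^{k+1}`
  have h2 : (5 : ZMod (2 ^ (k + 1 + 2))) ^ 2 ^ k = 1 := by
    have h3 : ((5 ^ 2 ^ k : ℕ) : ZMod (2 ^ (k + 1 + 2))) = ((2 ^ (k + 1 + 2) * q' + 1 : ℕ) : ZMod (2 ^ (k + 1 + 2))) := by
      rw [hq']; congr 1; ring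
    rw [Nat.cast_pow, Nat.cast_ofNat] at h3
    rw [h3, Nat.cast_add, Nat.cast_mul, ZMod.natCast_self, zero_mul, zero_add, Nat.cast_one]
  have hdvd : orderOf (5 : ZMod (2 ^ (k + 1 + 2))) ∣ 2 ^ k := orderOf_dvd_of_pow_eq_one h2
  rw [ZMod.orderOf_five (k + 1)] at hdvd
  have := Nat.le_of_dvd (by positivity) hdvd
  have : 2 ^ k < 2 ^ (k + 1) := Nat.pow_lt_pow_right (by norm_num) (by omega)
  omega

/-- `5` is prime to `2^{k+2}`. [folklore] -/
theorem coprime_five_two_pow (k : ℕ) : Nat.Coprime 5 (2 ^ (k + 2)) :=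
  ((Nat.coprime_primes (by norm_num) Nat.prime_two).mpr (by norm_num)).pow_right _

/-- **The half-system `{5^i : i < 2^k}` mod `2^{k+2}`**: `ord(5) = 2^k = φ(2^{k+2})/2`, and `5^i ≡ −5^j` is impossible
already mod `4` (`1 ≢ −1`).  So `(ℤ/2^{k+2})ˣ = ±⟨5⟩` and the powers of `5` are a CM type set.
research route conditional on HC_CM; not a corollary; Q11.4-sentence-2 already refuted in dim ≥ 3. [folklore] -/
theorem isCMTypeSet_powers_of_five (k : ℕ) :
    orderOf (ZMod.unitOfCoprime 5 (coprime_five_two_pow k)) = 2 ^ k ∧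
    IsCMTypeSet (2 ^ (k + 2)) ((Finset.range (2 ^ k)).image fun i =>
      ((ZMod.unitOfCoprime 5 (coprime_five_two_pow k) ^ i : (ZMod (2 ^ (k + 2)))ˣ) : ZMod (2 ^ (k + 2)))) := by
  set γ : (ZMod (2 ^ (k + 2)))ˣ := ZMod.unitOfCoprime 5 (coprime_five_two_pow k) with hγ
  have hγ5 : (γ : ZMod (2 ^ (k + 2))) = 5 := by
    rw [hγ, ZMod.coe_unitOfCoprime, Nat.cast_ofNat]
  have hordγ : orderOf γ = 2 ^ k := by
    rw [← orderOf_units, hγ5]; exact ZMod.orderOf_five k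
  refine ⟨hordγ, isCMTypeSet_image_pow γ ?_ hordγ.ge fun i _ j _ h => ?_⟩
  · rw [Nat.totient_prime_pow Nat.prime_two (by omega), show k + 2 - 1 = k + 1 by omega, pow_succ]
    ring
  · have h4 : 4 ∣ 2 ^ (k + 2) := ⟨2 ^ k, by ring⟩
    have h' := congrArg (ZMod.castHom h4 (ZMod 4)) h
    rw [map_neg, Units.val_pow_eq_pow_val, Units.val_pow_eq_pow_val, map_pow, map_pow, hγ5,
      map_ofNat, show (5 : ZMod 4) = 1 from by decide, one_pow, one_pow] at h'
    exact absurd h' (by decide)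

end Five

/-! ### §2 THE THEOREM at the levels `2^a`, `a ≥ 2`: Hasse's unit -/

section PowersOfTwo

variable {K : Type} [Field K] [NumberField K] [IsCMField K] {n : ℕ} [NeZero n] {ζ : K}

/-- **CONVERSE OF THEOREM L (i) AT `n = 2^a`, `a ≥ 2`.**  `𝓞 ℚ(ζₙ)⁺` has a unit of norm `−1`: HASSE'S UNIT
`u = ζ^{−2}(1 + ζ + ζ² + ζ³ + ζ⁴) = 1 + 2cos(2π/n) + 2cos(4π/n)`, whose norm, read on the half-system
`{5^i : i < 2^{a−2}}`, telescopes to `ζ^{−(5^{2^{a−2}} − 1)/2} = −1`.  (At `a = 2`: `u = −1 ∈ ℚ = ℚ(i)⁺`.)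
research route conditional on HC_CM; not a corollary; Q11.4-sentence-2 already refuted in dim ≥ 3. [cite: DummitDummitKisilevsky2019, §3 Prop. 2 ff. (Hasse's unit)] -/
theorem exists_units_norm_eq_neg_one_of_two_pow [IsCyclotomicExtension {n} ℚ K] (hζ : IsPrimitiveRoot ζ n) {k : ℕ}
    (hn : n = 2 ^ (k + 2)) :
    ∃ v : (𝓞 (maximalRealSubfield K))ˣ,
      Algebra.norm ℚ (((v : 𝓞 (maximalRealSubfield K)) : maximalRealSubfield K)) = -1 := by
  subst hn
  have hn4 : 4 ≤ 2 ^ (k + 2) :=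
    calc 4 = 2 ^ 2 := by norm_num
      _ ≤ 2 ^ (k + 2) := Nat.pow_le_pow_right two_pos (by omega)
  haveI : Fact (1 < 2 ^ (k + 2)) := ⟨by omega⟩
  obtain ⟨hordγ, hT⟩ := isCMTypeSet_powers_of_five k
  set γ : (ZMod (2 ^ (k + 2)))ˣ := ZMod.unitOfCoprime 5 (coprime_five_two_pow k) with hγ
  have hγ5 : (γ : ZMod (2 ^ (k + 2))) = ((5 : ℕ) : ZMod (2 ^ (k + 2))) := by rw [hγ, ZMod.coe_unitOfCoprime]
  set d : ℕ := 2 ^ k with hd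
  -- automorphisms `σ_t : ζ ↦ ζ^t`
  have hσ : ∀ t : ZMod (2 ^ (k + 2)), ∃ σ : K ≃ₐ[ℚ] K, t.val.Coprime (2 ^ (k + 2)) → σ ζ = ζ ^ t.val := fun t => by
    by_cases ht : t.val.Coprime (2 ^ (k + 2))
    · obtain ⟨σ, hσ⟩ := exists_aut_apply_eq_pow hζ t ht
      exact ⟨σ, fun _ => hσ⟩
    · exact ⟨AlgEquiv.refl, fun h => absurd h ht⟩
  choose σf hσf using hσ
  -- Hasse's unit as an algebraic integer
  set ζi : 𝓞 K := hζ.toInteger with hζi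
  have hζiprim : IsPrimitiveRoot ζi (2 ^ (k + 2)) := hζ.toInteger_isPrimitiveRoot
  set U : 𝓞 K := ζi ^ (2 ^ (k + 2) - 2) * ∑ i ∈ Finset.range 5, ζi ^ i with hU
  have hUunit : IsUnit U :=
    ((hζiprim.isUnit (NeZero.ne _)).pow _).mul (hζiprim.geom_sum_isUnit (by omega) (coprime_five_two_pow k))
  have hζ0 : ζ ≠ 0 := hζ.ne_zero (NeZero.ne _)
  have hU' : ((U : 𝓞 K) : K) = ζ ^ (2 ^ (k + 2) - 2) * ∑ i ∈ Finset.range 5, ζ ^ i := by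
    rw [hU]; push_cast; rfl
  -- `u = 1 + (ζ + ζ⁻¹) + (ζ² + ζ⁻²)` is real
  have hw : ζ ^ (2 ^ (k + 2) - 2) * ζ ^ 2 = 1 := by
    rw [← pow_add, Nat.sub_add_cancel (by omega), hζ.pow_eq_one]
  have hUsym : ((U : 𝓞 K) : K) = 1 + (ζ + ζ⁻¹) + (ζ ^ 2 + (ζ ^ 2)⁻¹) := by
    rw [hU', eq_inv_of_mul_eq_one_left hw]
    simp only [Finset.sum_range_succ, Finset.sum_range_zero]
    field_simp
    ring
  have hUreal : IsCMField.complexConj K ((U : 𝓞 K) : K) = U := by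
    rw [hUsym]
    simp only [map_add, map_one, map_inv₀, map_pow, complexConj_eq_inv hζ, inv_pow, inv_inv]
    ring
  -- `μ(j) = ζ^j − 1` and the factor `σ_a(u) = ζ^{a(n−2)}·μ(5a)/μ(a)`
  set μ : ℕ → K := fun j => ζ ^ j - 1 with hμ
  have hμ_mod : ∀ j j' : ℕ, j ≡ j' [MOD 2 ^ (k + 2)] → μ j = μ j' := fun j j' h => by
    simp only [hμ, pow_eq_pow_of_modEq hζ h]
  have hμ_ne : ∀ j : ℕ, j.Coprime (2 ^ (k + 2)) → μ j ≠ 0 := fun j hj h => by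
    have h1 : ζ ^ j = 1 := sub_eq_zero.mp h
    have := hj.symm.eq_one_of_dvd (hζ.dvd_of_pow_eq_one j h1)
    omega
  have hfacσ : ∀ (σ : K ≃ₐ[ℚ] K) (a : ℕ), a.Coprime (2 ^ (k + 2)) → σ ζ = ζ ^ a →
      σ ((U : 𝓞 K) : K) = ζ ^ (a * (2 ^ (k + 2) - 2)) * (μ (a * 5) / μ a) := by
    intro σ a ha h
    rw [hU', map_mul, map_pow, h, ← pow_mul, map_sum]
    simp_rw [map_pow, h, ← pow_mul]
    congr 1
    rw [eq_div_iff (hμ_ne a ha)]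
    have hgs := geom_sum_mul (ζ ^ a) 5
    simp_rw [← pow_mul] at hgs
    exact hgs
  -- the telescoping product over `T = {5^i : i < d}`
  set a : ℕ → ℕ := fun i => ((γ ^ i : (ZMod (2 ^ (k + 2)))ˣ) : ZMod (2 ^ (k + 2))).val with ha
  have ha_cop : ∀ i, (a i).Coprime (2 ^ (k + 2)) := fun i => ZMod.val_coe_unit_coprime _
  have ha0 : a 0 = 1 := by simp only [ha, pow_zero, Units.val_one, ZMod.val_one]
  have had : a d = 1 := by
    show ((γ ^ d : (ZMod (2 ^ (k + 2)))ˣ) : ZMod (2 ^ (k + 2))).val = 1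
    rw [← hordγ, pow_orderOf_eq_one, Units.val_one, ZMod.val_one]
  have ha_succ : ∀ i, a i * 5 ≡ a (i + 1) [MOD 2 ^ (k + 2)] := fun i => by
    have h1 := val_pow_succ_modEq γ i
    rw [hγ5, ZMod.val_natCast] at h1
    exact (Nat.ModEq.mul_left (a i) (Nat.mod_modEq 5 _)).symm.trans h1
  have hAS : (∑ i ∈ Finset.range d, a i) ≡ (∑ i ∈ Finset.range d, 5 ^ i) [MOD 2 ^ (k + 2)] := by
    rw [← ZMod.natCast_eq_natCast_iff, Nat.cast_sum, Nat.cast_sum]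
    refine Finset.sum_congr rfl fun i _ => ?_
    simp only [ha, ZMod.natCast_zmod_val, Units.val_pow_eq_pow_val, hγ5, Nat.cast_pow]
  -- `Σ_{i<d} 5^i = 2^k·q` with `q` odd, so `ζ^{(n−2)·Σ 5^i} = (ζ^{2^{k+1} q})⁻¹ = −1`
  have hS : (∑ i ∈ Finset.range d, 5 ^ i) * 4 + 1 = 5 ^ d := by
    have := geom_sum_mul_add 4 d
    norm_num at this
    exact this
  obtain ⟨q, hqodd, hq⟩ := five_pow_two_pow_eq k
  have hSq : ∑ i ∈ Finset.range d, 5 ^ i = 2 ^ k * q := by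
    apply Nat.eq_of_mul_eq_mul_right (show 0 < 4 by norm_num)
    have hq' : 5 ^ d = 2 ^ (k + 2) * q + 1 := hq
    have : (∑ i ∈ Finset.range d, 5 ^ i) * 4 = 2 ^ (k + 2) * q := by omega
    rw [this]; ring
  have hhalf : ζ ^ 2 ^ (k + 1) = -1 :=
    (hζ.pow (by positivity) (show 2 ^ (k + 2) = 2 ^ (k + 1) * 2 by ring)).eq_neg_one_of_two_right
  have h2S : ζ ^ (2 * ∑ i ∈ Finset.range d, 5 ^ i) = -1 := by
    rw [hSq, show 2 * (2 ^ k * q) = 2 ^ (k + 1) * q by ring, pow_mul, hhalf, hqodd.neg_one_pow]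
  have hfin : ζ ^ ((∑ i ∈ Finset.range d, 5 ^ i) * (2 ^ (k + 2) - 2)) = -1 := by
    have h1 : ζ ^ ((∑ i ∈ Finset.range d, 5 ^ i) * (2 ^ (k + 2) - 2)) *
        ζ ^ (2 * ∑ i ∈ Finset.range d, 5 ^ i) = 1 := by
      rw [← pow_add, mul_comm 2 (∑ i ∈ Finset.range d, 5 ^ i), ← mul_add, Nat.sub_add_cancel (by omega),
        mul_comm, pow_mul, hζ.pow_eq_one, one_pow]
    rw [h2S] at h1
    linear_combination -h1
  have hprod : ∏ t ∈ (Finset.range d).image (fun i => ((γ ^ i : (ZMod (2 ^ (k + 2)))ˣ) : ZMod (2 ^ (k + 2)))),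
      σf t ((U : 𝓞 K) : K) = -1 := by
    rw [Finset.prod_image (coe_pow_injOn γ hordγ.ge)]
    have hfac : ∀ i ∈ Finset.range d, σf ((γ ^ i : (ZMod (2 ^ (k + 2)))ˣ) : ZMod (2 ^ (k + 2))) ((U : 𝓞 K) : K) =
        ζ ^ (a i * (2 ^ (k + 2) - 2)) * (μ (a (i + 1)) / μ (a i)) := by
      intro i _
      rw [hfacσ _ (a i) (ha_cop i) (hσf _ (ha_cop i)), hμ_mod _ _ (ha_succ i)]
    rw [Finset.prod_congr rfl hfac, Finset.prod_mul_distrib,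
      prod_range_div_telescope (fun i => μ (a i)) (fun i _ => hμ_ne _ (ha_cop i)), had, ha0,
      div_self (hμ_ne 1 (Nat.coprime_one_left _)), mul_one, Finset.prod_pow_eq_pow_sum, ← Finset.sum_mul,
      pow_eq_pow_of_modEq hζ (hAS.mul_right _), hfin]
  obtain ⟨v, -, hv⟩ := exists_units_norm_eq_neg_one_of_prod_aut hζ hT hσf hUunit hUreal hprod
  exact ⟨v, hv⟩

end PowersOfTwo

/-! ### §3 THE DICHOTOMY: units of norm `−1` in `ℚ(ζₙ)⁺` exist iff `n ∈ {2^a, p^a, 2p^a}` -/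

section Dichotomy

variable {K : Type} [Field K] [NumberField K] [IsCMField K] {n : ℕ} [NeZero n] {ζ : K}

omit [IsCMField K] [NeZero n] in
/-- A unit of `𝓞 K⁺` has norm `+1` or `−1`.
research route conditional on HC_CM; not a corollary; Q11.4-sentence-2 already refuted in dim ≥ 3. [folklore] -/
theorem norm_units_eq_one_or_eq_neg_one (v : (𝓞 (maximalRealSubfield K))ˣ) :
    Algebra.norm ℚ (((v : 𝓞 (maximalRealSubfield K)) : maximalRealSubfield K)) = 1 ∨
      Algebra.norm ℚ (((v : 𝓞 (maximalRealSubfield K)) : maximalRealSubfield K)) = -1 := by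
  have hvZ : IsUnit (Algebra.norm ℤ (v : 𝓞 (maximalRealSubfield K))) := v.isUnit.map _
  have hnormQ : Algebra.norm ℚ (((v : 𝓞 (maximalRealSubfield K)) : maximalRealSubfield K)) =
      ((Algebra.norm ℤ (v : 𝓞 (maximalRealSubfield K)) : ℤ) : ℚ) :=
    (Algebra.coe_norm_int _).symm
  rcases Int.isUnit_iff.mp hvZ with h | h
  · left; rw [hnormQ, h]; norm_num
  · right; rw [hnormQ, h]; norm_num

/-- **CONVERSE OF THEOREM L (i)**: at EVERY exceptional level `n ∈ {2^a, p^a, 2p^a}`, `n ≥ 3`, the ring `𝓞 ℚ(ζₙ)⁺` has a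
unit of norm `−1` (part 72 at `p^a, 2p^a`; §2 at `2^a`).
research route conditional on HC_CM; not a corollary; Q11.4-sentence-2 already refuted in dim ≥ 3. [cite: Garbanati1976UnitsNormMinusOne] -/
theorem exists_units_norm_eq_neg_one_of_exceptional [IsCyclotomicExtension {n} ℚ K] (hζ : IsPrimitiveRoot ζ n)
    (hn2 : 2 < n) (hex : (∃ a : ℕ, n = 2 ^ a) ∨ ∃ p a : ℕ, p.Prime ∧ p ≠ 2 ∧ (n = p ^ a ∨ n = 2 * p ^ a)) :
    ∃ v : (𝓞 (maximalRealSubfield K))ˣ,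
      Algebra.norm ℚ (((v : 𝓞 (maximalRealSubfield K)) : maximalRealSubfield K)) = -1 := by
  rcases hex with ⟨a, ha⟩ | ⟨p, a, hp, hp2, h⟩
  · have ha2 : 2 ≤ a := by
      by_contra hlt
      push Not at hlt
      interval_cases a <;> omega
    obtain ⟨k, rfl⟩ := Nat.exists_eq_add_of_le' ha2
    exact exists_units_norm_eq_neg_one_of_two_pow hζ ha
  · have ha0 : a ≠ 0 := by
      rintro rfl
      rw [pow_zero] at h
      omega
    rcases h with h | h
    · exact exists_units_norm_eq_neg_one_of_prime_pow hζ hp hp2 ha0 h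
    · exact exists_units_norm_eq_neg_one_of_two_mul_prime_pow hζ hp hp2 ha0 h

/-- **THE DICHOTOMY (Garbanati–Weber for cyclotomic fields).**  For `K = ℚ(ζₙ)`, `n ≥ 3`:
`𝓞 K⁺` has a unit of norm `−1` **iff** `n = 2^a`, `n = p^a` or `n = 2p^a` for an odd prime `p`
(⟸ §2 and part 72; ⟹ part 68: at every other level all units have norm `+1`).
research route conditional on HC_CM; not a corollary; Q11.4-sentence-2 already refuted in dim ≥ 3. [cite: Garbanati1976UnitsNormMinusOne] [cite: Washington1997, §8.1, Lemma 8.1 (p. 144)] -/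
theorem exists_units_norm_eq_neg_one_iff [IsCyclotomicExtension {n} ℚ K] (hζ : IsPrimitiveRoot ζ n)
    (hn2 : 2 < n) :
    (∃ v : (𝓞 (maximalRealSubfield K))ˣ,
        Algebra.norm ℚ (((v : 𝓞 (maximalRealSubfield K)) : maximalRealSubfield K)) = -1) ↔
      ((∃ a : ℕ, n = 2 ^ a) ∨ ∃ p a : ℕ, p.Prime ∧ p ≠ 2 ∧ (n = p ^ a ∨ n = 2 * p ^ a)) := by
  refine ⟨fun ⟨v, hv⟩ => ?_, exists_units_norm_eq_neg_one_of_exceptional hζ hn2⟩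
  by_contra hne
  push Not at hne
  have := norm_realUnits_pos_of_not_exceptional hζ hne.1 hne.2 v
  rw [hv] at this
  norm_num at this

/-- **`hN` DECIDED.**  For `K = ℚ(ζₙ)`, `n ≥ 3`: the census hypothesis «every unit of `𝓞 K⁺` has positive norm»
(THEOREM L (i); parts 2/7/48/53/55/60b) holds **iff** `n ∉ {2^a, p^a, 2p^a}`.
research route conditional on HC_CM; not a corollary; Q11.4-sentence-2 already refuted in dim ≥ 3. [cite: Garbanati1976UnitsNormMinusOne] [cite: Washington1997, §8.1, Lemma 8.1 (p. 144)] -/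
theorem forall_norm_pos_iff [IsCyclotomicExtension {n} ℚ K] (hζ : IsPrimitiveRoot ζ n) (hn2 : 2 < n) :
    (∀ v : (𝓞 (maximalRealSubfield K))ˣ,
        0 < Algebra.norm ℚ (((v : 𝓞 (maximalRealSubfield K)) : maximalRealSubfield K))) ↔
      ((∀ a : ℕ, n ≠ 2 ^ a) ∧ ∀ p a : ℕ, p.Prime → p ≠ 2 → n ≠ p ^ a ∧ n ≠ 2 * p ^ a) := by
  constructor
  · intro h
    by_contra hne
    have hex : (∃ a : ℕ, n = 2 ^ a) ∨ ∃ p a : ℕ, p.Prime ∧ p ≠ 2 ∧ (n = p ^ a ∨ n = 2 * p ^ a) := by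
      by_contra h'
      push Not at h'
      exact hne h'
    obtain ⟨v, hv⟩ := exists_units_norm_eq_neg_one_of_exceptional hζ hn2 hex
    have := h v
    rw [hv] at this
    norm_num at this
  · rintro ⟨h2, hp⟩ v
    exact norm_realUnits_pos_of_not_exceptional hζ h2 hp v

/-- **Cyclic-or-power-of-two form**: for `n ≥ 3`, `𝓞 ℚ(ζₙ)⁺` has a unit of norm `−1` iff `(ℤ/n)ˣ` is cyclic or `n`
is a power of `2` (Mathlib `ZMod.isCyclic_units_iff`).
research route conditional on HC_CM; not a corollary; Q11.4-sentence-2 already refuted in dim ≥ 3. [cite: Garbanati1976UnitsNormMinusOne] -/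
theorem exists_units_norm_eq_neg_one_iff_isCyclic_or [IsCyclotomicExtension {n} ℚ K] (hζ : IsPrimitiveRoot ζ n)
    (hn2 : 2 < n) :
    (∃ v : (𝓞 (maximalRealSubfield K))ˣ,
        Algebra.norm ℚ (((v : 𝓞 (maximalRealSubfield K)) : maximalRealSubfield K)) = -1) ↔
      (IsCyclic (ZMod n)ˣ ∨ ∃ a : ℕ, n = 2 ^ a) := by
  rw [exists_units_norm_eq_neg_one_iff hζ hn2, ZMod.isCyclic_units_iff]
  constructor
  · rintro (⟨a, ha⟩ | ⟨p, a, hp, hp2, h⟩)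
    · exact Or.inr ⟨a, ha⟩
    · refine Or.inl (Or.inr (Or.inr (Or.inr (Or.inr ⟨p, a, hp, hp.odd_of_ne_two hp2, ?_, h⟩))))
      by_contra h0
      push Not at h0
      interval_cases a
      rw [pow_zero] at h
      omega
  · rintro ((h0 | h1 | h2 | h4 | ⟨p, m, hp, hodd, -, h⟩) | ⟨a, ha⟩)
    · omega
    · omega
    · omega
    · exact Or.inl ⟨2, by rw [h4]; norm_num⟩
    · refine Or.inr ⟨p, m, hp, ?_, h⟩
      rintro rfl
      exact absurd hodd (by decide)
    · exact Or.inl ⟨a, ha⟩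

end Dichotomy

end Summit.HodgeConjecture.Ring2WeilCoverage.RealUnitNormPowersOfTwo

end
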